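import Literature.RepresentationTheory.Semisimple.GradedOrbitStrings
import Literature.RepresentationTheory.Semisimple.GradedOrbitRetract
import HarnessLib

/-!
# Graded modules with a degree-one endomorphism, III: strings reach the top of occupied intervals

This file is part of a small self-contained series (`GradedOrbitStrings`, `GradedOrbitRetract`,
`GradedOrbitReaching`, `GradedOrbitDegreewise`, `GradedOrbitConj`) proving the following
**conjugacy theorem** (`exists_graded_linearEquiv_conj`): let `R` be a ring containing a field
`K`, `M = ⨁_{k<N} gr k` a graded `R`-module, finite-dimensional over `K` and semisimple over
`R`, and `t`, `t'` two `R`-endomorphisms of degree `+1` which are *generic* — no non-zero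
`R`-endomorphism of degree `-1` commutes with them; then `t' = g t g⁻¹` for a degree-preserving
`R`-automorphism `g`.  For `R = K` this is the uniqueness of the rigid (= open-orbit)
representation of the equioriented quiver of type `A` with a given dimension vector; in the
language of Zelevinsky (*Induced representations of reductive 𝔭-adic groups II*, Ann. ÉNS 13
(1980), §§4, 8) it says that the multisegment with pairwise *unlinked* segments on a given
support is unique.  With `R = ℂ[W_K]` acting through a twisted Weil-group action it yields
A'Campo–Hevesi–Thorne–Whitmore, arXiv:2607.11763, Prop. 6.0.5 (2) (generic monodromy
operators on a fixed Frobenius-semisimple Weil representation form one orbit under the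
centraliser), see `Literature/NumberTheory/GaloisRepresentations/GenericWeilDeligneOrbitProofs`.

The proof is elementary and module-theoretic (no algebraic geometry, no Gabriel / Krull–Schmidt):
a *string* is `Z = ⨁_{r ≤ n} tʳ e(S)` for a simple `S` and `e : S → gr p`; a string born in a
degree `p` below which `S` does not occur splits off `t`-stably and compatibly with the grading
(`exists_isCompl_stringSum`); genericity passes to such summands; in a generic module the string
born at the bottom of a maximal interval of degrees occupied by `S` reaches its top
(`exists_comp_pow_ne_zero_of_occupied`); split off such longest strings for `t` and `t'`, cancel
the simple summands degreewise, and induct on `dim_K M`.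

Conventions.  Everything is stated without auxiliary definitions: a grading is a family
`gr : ℕ → Submodule R M` (with `iSupIndep gr`, `⨆ gr = ⊤` and `gr k = ⊥` for `k ≥ N` where
needed); "`t` has degree `+1`" is `∀ k, ∀ x ∈ gr k, t x ∈ gr (k + 1)`; a *string sum* is any
linear map `Ψ : (Fin (n+1) → S) →ₗ[R] M` with `Ψ s = ∑ r, t ^ (a + r) (e (s r))` (hypothesis
`hΨ`), so that lemmas apply to `∑ r, (t ^ r ∘ₗ e) ∘ₗ LinearMap.proj r` by `simp`.

## This file

* `exists_comp_pow_ne_zero_of_occupied` — in a generic graded semisimple module, if the simple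
  type `S` does not occur in degree `p - 1` but occurs in every degree `p, …, q`, then some
  `e : S → gr p` has `t^{q-p} e ≠ 0`.  Proof by induction on `dim_K M`: otherwise split off a
  longest string from degree `p`; either the complement still has `S` in all degrees
  `p … p+m+1` (induction gives a longer string), or it has a top-most hole `k₀`, above which
  induction provides a long string `U` in the complement; mapping `U` down onto the split-off
  string is a non-zero degree `-1` endomorphism commuting with `t`, contradicting genericity.
-/

namespace Literature.RepresentationTheory.Semisimple

open Module

variable {R : Type*} [Ring R] {M : Type*} [AddCommGroup M] [Module R M]

section Reaching

variable {K : Type*} [Field K] [Algebra K R]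

/-- **Strings reach the end of an occupied interval.**  Let `M` be a graded finite-dimensional
semisimple module with `t` of degree `+1` and generic (`t` commutes with no non-zero degree `-1`
endomorphism).  Let `S` be simple, not occurring in degree `p - 1` but occurring in every degree
`p, p+1, …, q`.  Then some copy `e : S → gr p` has `t^{q-p} e ≠ 0` — the segment starting at
the bottom `p` of a maximal occupied interval runs to its top.  (Module-theoretic core of the
uniqueness of the pairwise-unlinked multisegment with given support; proved by induction on
the dimension, splitting off strings.) [folklore] -/
theorem exists_comp_pow_ne_zero_of_occupied
    {S : Type*} [AddCommGroup S] [Module R S] [IsSimpleModule R S] (n : ℕ) :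
    ∀ {M : Type*} [AddCommGroup M] [Module K M] [Module R M] [IsScalarTower K R M]
      [FiniteDimensional K M] [IsSemisimpleModule R M]
      (gr : ℕ → Submodule R M) (_ : iSupIndep gr) (_ : ⨆ k, gr k = ⊤)
      (N : ℕ) (_ : ∀ k, N ≤ k → gr k = ⊥)
      (t : M →ₗ[R] M) (_ : ∀ k, ∀ x ∈ gr k, t x ∈ gr (k + 1))
      (_ : ∀ f : M →ₗ[R] M, (∀ x ∈ gr 0, f x = 0) →
        (∀ k, ∀ x ∈ gr (k + 1), f x ∈ gr k) → f ∘ₗ t = t ∘ₗ f → f = 0)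
      (p q : ℕ) (_ : p ≤ q)
      (_ : ∀ k, k + 1 = p → ∀ u : S →ₗ[R] M, (∀ s, u s ∈ gr k) → u = 0)
      (_ : ∀ k, p ≤ k → k ≤ q → ∃ u : S →ₗ[R] M, u ≠ 0 ∧ ∀ s, u s ∈ gr k),
      finrank K M ≤ n →
      ∃ e : S →ₗ[R] M, (∀ s, e s ∈ gr p) ∧ (t ^ (q - p)) ∘ₗ e ≠ 0 := by
  induction n with
  | zero =>
    intro M _ _ _ _ _ _ gr hind hsup N hN t ht hgen p q hpq hp hocc hdim
    exfalso
    obtain ⟨u, hu, -⟩ := hocc p le_rfl hpq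
    haveI : Subsingleton M := Module.finrank_zero_iff.mp (Nat.le_zero.mp hdim)
    exact hu (Subsingleton.elim _ _)
  | succ n ih =>
    intro M _ _ _ _ _ _ gr hind hsup N hN t ht hgen p q hpq hp hocc hdim
    classical
    by_contra hcon
    push Not at hcon
    -- the minimal exponent killing every copy of `S` in degree `p`
    have hex : ∃ c, ∀ e : S →ₗ[R] M, (∀ s, e s ∈ gr p) → (t ^ c) ∘ₗ e = 0 := ⟨q - p, hcon⟩
    have hc := Nat.find_spec hex
    have hc0 : Nat.find hex ≠ 0 := by
      intro h0
      obtain ⟨u, hu, hu'⟩ := hocc p le_rfl hpq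
      apply hu
      have := hc u hu'
      rwa [h0, pow_zero, Module.End.one_eq_id, LinearMap.id_comp] at this
    obtain ⟨m, hm⟩ : ∃ m, Nat.find hex = m + 1 := Nat.exists_eq_succ_of_ne_zero hc0
    have hmq : p + m + 1 ≤ q := by
      have : Nat.find hex ≤ q - p := Nat.find_min' hex hcon
      omega
    have hm' := Nat.find_min hex (show m < Nat.find hex by omega)
    push Not at hm'
    obtain ⟨e, he, hem⟩ := hm'
    have hem' : (t ^ (m + 1)) ∘ₗ e = 0 := hm ▸ hc e he
    -- the string of `e` and its complement
    let Ψ : (Fin (m + 1) → S) →ₗ[R] M :=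
      ∑ r : Fin (m + 1), ((t ^ (r : ℕ)) ∘ₗ e) ∘ₗ LinearMap.proj r
    have hΨ : ∀ s, Ψ s = ∑ r : Fin (m + 1), (t ^ (r : ℕ)) (e (s r)) := by
      intro s; simp [Ψ, LinearMap.sum_apply]
    have hΨ' : ∀ s, Ψ s = ∑ r : Fin (m + 1), (t ^ (0 + (r : ℕ))) (e (s r)) := by
      simpa using hΨ
    obtain ⟨hΨinj, C, hZC, hCt, hsplit⟩ :=
      exists_isCompl_stringSum gr hind hsup t ht e he hem hp Ψ hΨ
    set Z := LinearMap.range Ψ with hZdef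
    have hZt : ∀ x ∈ Z, t x ∈ Z := by
      rintro _ ⟨s, rfl⟩
      rw [apply_stringSum_eq_stringSum_shift t e 0 (by simpa using hem') Ψ hΨ' s]
      exact ⟨_, rfl⟩
    have hdeg : ∀ k, ∀ x ∈ gr k, ∃ z ∈ Z, ∃ y ∈ C, y ∈ gr k ∧ x = z + y := by
      intro k x hx
      obtain ⟨r, s₀, y, hyC, hyk, -, rfl⟩ := hsplit k x hx
      exact ⟨_, ⟨_, rfl⟩, y, hyC, hyk, rfl⟩
    -- the complement as a graded module
    set grC : ℕ → Submodule R C := fun k => (gr k).comap C.subtype with hgrC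
    obtain ⟨hindC, hsupC⟩ := iSupIndep_comap_subtype_of_isCompl gr hind hsup Z C hZC hdeg
    have hNC : ∀ k, N ≤ k → grC k = ⊥ := by
      intro k hk
      simp only [hgrC, hN k hk, Submodule.comap_bot, Submodule.ker_subtype]
    set tC : C →ₗ[R] C := t.restrict hCt with htC
    have htC' : ∀ k, ∀ x ∈ grC k, tC x ∈ grC (k + 1) := fun k x hx => ht k x hx
    have hgenC : ∀ f : C →ₗ[R] C, (∀ x ∈ grC 0, f x = 0) →
        (∀ k, ∀ x ∈ grC (k + 1), f x ∈ grC k) → f ∘ₗ tC = tC ∘ₗ f → f = 0 :=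
      forall_eq_zero_of_isCompl_restrict gr t hgen Z C hZC hZt hCt hdeg
    have hpowC : ∀ (j : ℕ) (x : C), ((tC ^ j) x : M) = (t ^ j) (x : M) := by
      intro j x
      rw [htC, Module.End.pow_restrict j hCt, LinearMap.coe_restrict_apply]
    haveI : FiniteDimensional K C := finite_of_submodule K C
    -- dimension drops
    have hdimC : finrank K C ≤ n := by
      have h1 := finrank_add_finrank_of_isCompl K hZC
      haveI := finite_of_submodule K Z
      haveI : Nontrivial Z := by
        rw [Submodule.nontrivial_iff_ne_bot]
        intro hZ0
        apply hem
        have he0 : e = 0 := by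
          ext s
          have hmem : Ψ (Pi.single 0 s) ∈ Z := ⟨_, rfl⟩
          rw [hZ0, Submodule.mem_bot, stringSum_single t e 0 Ψ hΨ' 0 s] at hmem
          simpa using hmem
        rw [he0, LinearMap.comp_zero]
      have h2 : 0 < finrank K Z := Module.finrank_pos
      omega
    -- occupancy in `C`
    have hoccC : ∀ k, (k < p ∨ p + m < k) → (∃ u : S →ₗ[R] M, u ≠ 0 ∧ ∀ s, u s ∈ gr k) →
        ∃ u : S →ₗ[R] C, u ≠ 0 ∧ ∀ s, u s ∈ grC k := by
      rintro k hk ⟨u, hu0, hu⟩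
      have huC : ∀ s, u s ∈ C := by
        intro s
        obtain ⟨r, s₀, y, hyC, -, hs₀, hus⟩ := hsplit k (u s) (hu s)
        have : s₀ = 0 := by
          by_contra hne
          have := hs₀ hne
          have hr : (r : ℕ) ≤ m := Fin.is_le r
          omega
        rw [hus, this, Pi.single_zero, map_zero, zero_add]
        exact hyC
      refine ⟨u.codRestrict C huC, ?_, fun s => hu s⟩
      intro h0; apply hu0; ext s
      exact congrArg Subtype.val (congr($h0 s))
    have hnoccC : ∀ k, (∀ u : S →ₗ[R] M, (∀ s, u s ∈ gr k) → u = 0) →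
        ∀ u : S →ₗ[R] C, (∀ s, u s ∈ grC k) → u = 0 := by
      intro k hk u hu
      have := hk (C.subtype ∘ₗ u) fun s => hu s
      ext s
      exact congr($this s)
    have hocc_top : ∃ u : S →ₗ[R] C, u ≠ 0 ∧ ∀ s, u s ∈ grC (p + m + 1) :=
      hoccC _ (Or.inr (by omega)) (hocc _ (by omega) hmq)
    by_cases hall : ∀ k, p ≤ k → k ≤ p + m → ∃ u : S →ₗ[R] C, u ≠ 0 ∧ ∀ s, u s ∈ grC k
    · -- Case 1: `S` occurs in `C` in all degrees `p … p+m+1`; a string of length `m+2` in `C`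
      obtain ⟨eC, heC, heC'⟩ := ih grC hindC hsupC N hNC tC htC' hgenC p (p + m + 1) (by omega)
        (fun k hk => hnoccC k (hp k hk)) (fun k hk1 hk2 => by
          rcases Nat.lt_or_ge (p + m) k with h | h
          · obtain rfl : k = p + m + 1 := by omega
            exact hocc_top
          · exact hall k hk1 h) hdimC
      apply heC'
      have h0 := hc (C.subtype ∘ₗ eC) fun s => heC s
      ext s
      rw [LinearMap.comp_apply, hpowC, show p + m + 1 - p = Nat.find hex by omega]
      exact congr($h0 s)
    · -- Case 2: a hole `k₀ ∈ [p, p+m]` for `S` in `C`; take the top-most one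
      push Not at hall
      obtain ⟨k₁, hk₁p, hk₁m, hk₁⟩ := hall
      have hexj : ∃ j, ∀ u : S →ₗ[R] C, (∀ s, u s ∈ grC (p + m - j)) → u = 0 := by
        refine ⟨p + m - k₁, fun u hu => ?_⟩
        rw [show p + m - (p + m - k₁) = k₁ by omega] at hu
        by_contra hne
        obtain ⟨s, hs⟩ := hk₁ u hne
        exact hs (hu s)
      have hj₀ := Nat.find_spec hexj
      have hj₀le : Nat.find hexj ≤ p + m - k₁ := Nat.find_min' hexj (by
        intro u hu
        rw [show p + m - (p + m - k₁) = k₁ by omega] at hu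
        by_contra hne
        obtain ⟨s, hs⟩ := hk₁ u hne
        exact hs (hu s))
      set k₀ := p + m - Nat.find hexj with hk₀
      have hk₀p : p ≤ k₀ := by omega
      have hk₀m : k₀ ≤ p + m := by omega
      have hOcc_above : ∀ k, k₀ < k → k ≤ p + m + 1 →
          ∃ u : S →ₗ[R] C, u ≠ 0 ∧ ∀ s, u s ∈ grC k := by
        intro k hk1 hk2
        rcases Nat.lt_or_ge (p + m) k with h | h
        · obtain rfl : k = p + m + 1 := by omega
          exact hocc_top
        · have hmin := Nat.find_min hexj (show p + m - k < Nat.find hexj by omega)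
          rw [show p + m - (p + m - k) = k by omega] at hmin
          push Not at hmin
          obtain ⟨u, hu, hne⟩ := hmin
          exact ⟨u, hne, hu⟩
      have hnoccC₀ : ∀ u : S →ₗ[R] C, (∀ s, u s ∈ grC k₀) → u = 0 := hj₀
      obtain ⟨u, hu, hu'⟩ := ih grC hindC hsupC N hNC tC htC' hgenC (k₀ + 1) (p + m + 1)
        (by omega) (fun k hk => by
          obtain rfl : k = k₀ := by omega
          exact hnoccC₀)
        (fun k hk1 hk2 => hOcc_above k (by omega) hk2) hdimC
      -- the string of `u` in `C`
      have hexc : ∃ c', (tC ^ c') ∘ₗ u = 0 := by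
        refine ⟨N, ?_⟩
        ext s
        have := pow_apply_mem_gr grC tC htC' (hu s) N
        rw [hNC (k₀ + 1 + N) (by omega), Submodule.mem_bot] at this
        rw [LinearMap.comp_apply, this, LinearMap.zero_apply]
      have hc' := Nat.find_spec hexc
      have hc'ℓ : p + m + 1 - (k₀ + 1) < Nat.find hexc := by
        by_contra hge
        push Not at hge
        apply hu'
        rw [show p + m + 1 - (k₀ + 1) = (p + m + 1 - (k₀ + 1) - Nat.find hexc) + Nat.find hexc
          by omega, pow_add, Module.End.mul_eq_comp, LinearMap.comp_assoc, hc',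
          LinearMap.comp_zero]
      obtain ⟨m', hm'c⟩ : ∃ m', Nat.find hexc = m' + 1 :=
        Nat.exists_eq_succ_of_ne_zero (by omega)
      have hum' := Nat.find_min hexc (show m' < Nat.find hexc by omega)
      have hum'1 : (tC ^ (m' + 1)) ∘ₗ u = 0 := hm'c ▸ hc'
      let ΨU : (Fin (m' + 1) → S) →ₗ[R] C :=
        ∑ r : Fin (m' + 1), ((tC ^ (r : ℕ)) ∘ₗ u) ∘ₗ LinearMap.proj r
      have hΨU : ∀ s, ΨU s = ∑ r : Fin (m' + 1), (tC ^ (r : ℕ)) (u (s r)) := by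
        intro s; simp [ΨU, LinearMap.sum_apply]
      have hΨU' : ∀ s, ΨU s = ∑ r : Fin (m' + 1), (tC ^ (0 + (r : ℕ))) (u (s r)) := by
        simpa using hΨU
      obtain ⟨hΨUinj, C', hUC', hC't, hsplit'⟩ :=
        exists_isCompl_stringSum grC hindC hsupC tC htC' u hu hum' (fun k hk => by
          obtain rfl : k = k₀ := by omega
          exact hnoccC₀) ΨU hΨU
      -- the shifted string of `e` in `M`, of offset `a = k₀ - p`
      set a := k₀ - p with ha
      let Θ : (Fin (m' + 1) → S) →ₗ[R] M :=
        ∑ r : Fin (m' + 1), ((t ^ (a + (r : ℕ))) ∘ₗ e) ∘ₗ LinearMap.proj r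
      have hΘ : ∀ s, Θ s = ∑ r : Fin (m' + 1), (t ^ (a + (r : ℕ))) (e (s r)) := by
        intro s; simp [Θ, LinearMap.sum_apply]
      have hΘtop : (t ^ (a + (m' + 1))) ∘ₗ e = 0 := by
        rw [show a + (m' + 1) = (a + (m' + 1) - (m + 1)) + (m + 1) by omega, pow_add,
          Module.End.mul_eq_comp, LinearMap.comp_assoc, hem', LinearMap.comp_zero]
      let θU := LinearEquiv.ofInjective ΨU hΨUinj
      let fC : C →ₗ[R] M := LinearMap.ofIsCompl hUC' (Θ ∘ₗ θU.symm.toLinearMap) 0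
      have hfCΨ : ∀ s, fC (ΨU s) = Θ s := by
        intro s
        have h1 : fC ((⟨ΨU s, LinearMap.mem_range_self _ _⟩ : LinearMap.range ΨU) : C) =
            Θ (θU.symm ⟨ΨU s, LinearMap.mem_range_self _ _⟩) :=
          LinearMap.ofIsCompl_apply_left hUC' _
        rw [h1]
        congr 1
        apply hΨUinj
        exact LinearEquiv.ofInjective_symm_apply (f := ΨU) (h := hΨUinj) _
      have hfC' : ∀ y ∈ C', fC y = 0 := fun y hy => by
        have := LinearMap.ofIsCompl_apply_right hUC' (φ := Θ ∘ₗ θU.symm.toLinearMap)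
          (ψ := 0) ⟨y, hy⟩
        rw [LinearMap.zero_apply] at this
        exact this
      let f : M →ₗ[R] M := LinearMap.ofIsCompl hZC 0 fC
      have hfZ : ∀ z ∈ Z, f z = 0 := fun z hz => by
        have := LinearMap.ofIsCompl_apply_left hZC (φ := 0) (ψ := fC) ⟨z, hz⟩
        rw [LinearMap.zero_apply] at this
        exact this
      have hfC : ∀ (y : M) (hy : y ∈ C), f y = fC ⟨y, hy⟩ := fun y hy =>
        LinearMap.ofIsCompl_apply_right hZC (φ := 0) (ψ := fC) ⟨y, hy⟩
      -- (a) `f ≠ 0`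
      have hfne : f ≠ 0 := by
        have hae : (t ^ a) ∘ₗ e ≠ 0 := by
          intro h0; apply hem
          rw [show m = (m - a) + a by omega, pow_add, Module.End.mul_eq_comp,
            LinearMap.comp_assoc, h0, LinearMap.comp_zero]
        obtain ⟨s₀, hs₀⟩ : ∃ s₀, (t ^ a) (e s₀) ≠ 0 := by
          by_contra hall0
          push Not at hall0
          exact hae (LinearMap.ext hall0)
        intro hf0
        apply hs₀
        have h1 : f (u s₀ : M) = (t ^ a) (e s₀) := by
          rw [hfC _ (u s₀).2]
          have h2 : (⟨(u s₀ : M), (u s₀).2⟩ : C) = ΨU (Pi.single 0 s₀) := by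
            rw [stringSum_single tC u 0 ΨU hΨU' 0 s₀]
            simp
          rw [h2, hfCΨ, stringSum_single t e a Θ hΘ 0 s₀]
          simp
        rw [← h1, hf0, LinearMap.zero_apply]
      -- (b) `f` on homogeneous elements
      have hfdeg : ∀ k, ∀ x ∈ gr k, ∃ (r : Fin (m' + 1)) (s₁ : S),
          (s₁ ≠ 0 → k₀ + 1 + r = k) ∧ f x = (t ^ (a + (r : ℕ))) (e s₁) := by
        intro k x hx
        obtain ⟨r, s₀, y, hyC, hyk, -, rfl⟩ := hsplit k x hx
        obtain ⟨r', s₁, y', hy'C', -, hs₁, hyy⟩ := hsplit' k ⟨y, hyC⟩ hyk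
        refine ⟨r', s₁, hs₁, ?_⟩
        rw [map_add, hfZ _ ⟨_, rfl⟩, zero_add, hfC y hyC, hyy, map_add, hfC' y' hy'C', add_zero,
          hfCΨ, stringSum_single t e a Θ hΘ r' s₁]
      have hf0 : ∀ x ∈ gr 0, f x = 0 := by
        intro x hx
        obtain ⟨r, s₁, hs₁, hfx⟩ := hfdeg 0 x hx
        have : s₁ = 0 := by
          by_contra h
          have := hs₁ h
          omega
        rw [hfx, this, map_zero, map_zero]
      have hf1 : ∀ k, ∀ x ∈ gr (k + 1), f x ∈ gr k := by
        intro k x hx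
        obtain ⟨r, s₁, hs₁, hfx⟩ := hfdeg (k + 1) x hx
        rw [hfx]
        by_cases h : s₁ = 0
        · rw [h, map_zero, map_zero]; exact zero_mem _
        · have hk := hs₁ h
          have := pow_apply_mem_gr gr t ht (he s₁) (a + r)
          rwa [show p + (a + r) = k by omega] at this
      -- (c) `f` commutes with `t`
      have hft : f ∘ₗ t = t ∘ₗ f := by
        ext x
        obtain ⟨z, hz, y, hy, rfl⟩ := Submodule.mem_sup.mp
          ((hZC.sup_eq_top.symm ▸ Submodule.mem_top : x ∈ Z ⊔ C))
        simp only [LinearMap.comp_apply, map_add]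
        rw [hfZ _ (hZt z hz), hfZ z hz, map_zero, zero_add, zero_add]
        obtain ⟨υ, ⟨s, rfl⟩, y'', hy'', hυy⟩ := Submodule.mem_sup.mp
          ((hUC'.sup_eq_top.symm ▸ Submodule.mem_top : (⟨y, hy⟩ : C) ∈ LinearMap.range ΨU ⊔ C'))
        have hyeq : y = (ΨU s : M) + (y'' : M) := by
          have := congrArg Subtype.val hυy
          exact this.symm
        rw [hyeq, map_add, map_add, map_add, map_add]
        have e1 : t (ΨU s : M) = (ΨU (Fin.cons 0 (Fin.init s)) : M) := by
          rw [← apply_stringSum_eq_stringSum_shift tC u 0 (by simpa using hum'1) ΨU hΨU' s]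
          rfl
        have e2 : t (y'' : M) = (tC y'' : M) := rfl
        rw [e1, e2, hfC _ (ΨU _).2, hfC _ (tC y'').2, hfC _ (ΨU s).2, hfC _ y''.2]
        simp only [Subtype.coe_eta]
        rw [hfCΨ, hfCΨ, hfC' _ (hC't _ hy''), hfC' _ hy'', map_zero, add_zero, add_zero,
          apply_stringSum_eq_stringSum_shift t e a hΘtop Θ hΘ s]
      exact hfne (hgen f hf0 hf1 hft)

end Reaching

end Literature.RepresentationTheory.Semisimple
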